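import Summits.CriticalPhenomena.PercolationContinuityZ3.Theorems.PercNearOneGluingNoHeavyQuantLSCoreMMGIneqA
import Mathlib.Tactic.Linarith
import Mathlib.Tactic.FieldSimp
import Mathlib.Tactic.Ring
import Mathlib.Tactic.Positivity
import HarnessLib

/-!
# QUANT lane R8, T-DEC, binder (II) `ConvClosedTResidue`: LS-CORE, pattern LMG — the breakpoint inequalities of the two-low greedy after
# pre-routing the row-`m` low `m+l` into the head cell, by case analysis over the letters of the cross pairs (G0+kA)

builds on p205010 (kernel theorem, internal audit signed; external expert review pending)

Support file (`--supports stmt-CriticalPhenomena-4575`), QUANT lane seat prim-quant-census-1 (gen 22), rung R8 of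
`run/shared/lean/prim/quant/LADDER.md`.  Theorems only, standard axioms, no sorries.  Memo `…/prim-quant-census-1/LSCORE-G22.md` §9–§10.

Scale-free coordinates of `…QuantLSCoreMMGIneqA` (`x, r, t, d, w`); efficiencies `e2P, e22` (low `p+l′` into `p+h`, `m+l′`), `e3` (the
pre-routed low `m+l` into `p+h`, deficit `r+d+2t−2w`, span `1+t−w`), the head-cell exchange ratio `κ`, and the residual head-cell capacity
`cPres` / residual pool `poolres` after pre-routing (fits: `cPres = c_P − d₁/e3`, `poolres = pool`; saturates: `cPres = 0`,
`poolres = pool − d₁ + c_P·e3`), all given by conditional closed forms.  The lemmas are the hypotheses `hkG`, `hkB` (and the facts used for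
`hkA`) of `LawDec.twoLow_greedy_flows` for pattern LMG; every leaf is one cell of `…QuantLSCoreLMGIneq*`.

[this work].  The gluing rows served [cite: KozmaNitzan2024, Conjecture 3 (p. 15)]; product measure [cite: Grimmett1999, §1.3 p. 10].
-/

namespace Summit.CriticalPhenomena.PercolationContinuityZ3.Theorems

namespace Quant

namespace LawDec

namespace LSCoreLMG

set_option maxHeartbeats 8000000 in
/-- **`G0` for pattern LMG**: the residual giant pool after pre-routing `m+l` is nonnegative. [this work] -/
theorem G0_LMG (x r t d w e3 cPres poolres : ℝ) (hx0 : 0 < x) (hx1 : x < 1) (hr0 : 0 ≤ r) (hrx : r < x) (_ht : 0 < t) (hw0 : 0 < w) (_hw1 : w ≤ 1)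
    (_hd0 : 0 ≤ d) (_hdx : d < x * w) (hre : 0 < r - x + t * (2 - x)) (_hre1 : 0 < 1 - t - r)
    (_hM1 : 2 * w < r + d + 2 * t) (_hM2 : r + d ≤ 2 * w)
    (h3_H : x * (1 + t - w) ≤ (r + d + 2 * t - 2 * w) → e3 = (((1 + t - w) - (r + d + 2 * t - 2 * w)) / (r + d + 2 * t - 2 * w)))
    (h3_L : (r + d + 2 * t - 2 * w) < x * (1 + t - w) → e3 = (((1 + t - w) - ((1 - x) * (r + d + 2 * t - 2 * w) + x ^ (2:ℕ) * (1 + t - w))) / ((1 - x) * (r + d + 2 * t - 2 * w) + x ^ (2:ℕ) * (1 + t - w))))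
    (hcase_f : ((x ^ (2:ℕ) + (1 - x) * d / w) * (1 - x) * ((x - r) * (1 - t - r) / (t * (2 - x ^ (2:ℕ) - (1 - x) * r) - x * (x - r)))) ≤ ((1 - (x ^ (2:ℕ) + (1 - x) * d / w)) * x) * e3 → cPres = ((1 - (x ^ (2:ℕ) + (1 - x) * d / w)) * x) - ((x ^ (2:ℕ) + (1 - x) * d / w) * (1 - x) * ((x - r) * (1 - t - r) / (t * (2 - x ^ (2:ℕ) - (1 - x) * r) - x * (x - r)))) / e3 ∧ poolres = ((x ^ (2:ℕ) + (1 - x) * d / w) * (1 - x)))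
    (hcase_s : ((1 - (x ^ (2:ℕ) + (1 - x) * d / w)) * x) * e3 < ((x ^ (2:ℕ) + (1 - x) * d / w) * (1 - x) * ((x - r) * (1 - t - r) / (t * (2 - x ^ (2:ℕ) - (1 - x) * r) - x * (x - r)))) → cPres = 0 ∧ poolres = (((x ^ (2:ℕ) + (1 - x) * d / w) * (1 - x)) - ((x ^ (2:ℕ) + (1 - x) * d / w) * (1 - x) * ((x - r) * (1 - t - r) / (t * (2 - x ^ (2:ℕ) - (1 - x) * r) - x * (x - r)))) + ((1 - (x ^ (2:ℕ) + (1 - x) * d / w)) * x) * e3)) :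
    0 ≤ poolres := by
  have hD : 0 < t * (2 - x ^ (2:ℕ) - (1 - x) * r) - x * (x - r) := LSCoreMMG.D_pos x r t hx0 hx1 hr0 hrx hre
  have hxw : x * w ≤ x := by nlinarith
  have hxw1 : x * w ≤ w := by nlinarith
  have hb3c : r + d + 2 * t - 2 * w < 1 + t - w := by nlinarith
  have hg0 : 0 ≤ (x ^ (2:ℕ) + (1 - x) * d / w) := by positivity
  have hlaml : 0 ≤ ((1 + x - r) * (r - x + t * (2 - x)) / (t * (2 - x ^ (2:ℕ) - (1 - x) * r) - x * (x - r))) := div_nonneg (mul_nonneg (by linarith) hre.le) hD.le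
  have hsum : ((x - r) * (1 - t - r) / (t * (2 - x ^ (2:ℕ) - (1 - x) * r) - x * (x - r))) + ((1 + x - r) * (r - x + t * (2 - x)) / (t * (2 - x ^ (2:ℕ) - (1 - x) * r) - x * (x - r))) = 1 := by rw [← add_div, div_eq_one_iff_eq hD.ne']; ring
  have hP : ((1 - (x ^ (2:ℕ) + (1 - x) * d / w)) * (1 - x) * ((x - r) * (1 - t - r) / (t * (2 - x ^ (2:ℕ) - (1 - x) * r) - x * (x - r)))) + ((1 - (x ^ (2:ℕ) + (1 - x) * d / w)) * (1 - x) * ((1 + x - r) * (r - x + t * (2 - x)) / (t * (2 - x ^ (2:ℕ) - (1 - x) * r) - x * (x - r)))) = (1 - (x ^ (2:ℕ) + (1 - x) * d / w)) * (1 - x) := by linear_combination (1 - (x ^ (2:ℕ) + (1 - x) * d / w)) * (1 - x) * hsum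
  have hg1p : 0 ≤ 1 - (x ^ (2:ℕ) + (1 - x) * d / w) := by
    have h4 : d / w ≤ x := by rw [div_le_iff₀ hw0]; linarith
    have h5 : (1 - x) * d / w ≤ (1 - x) * x := by rw [mul_div_assoc]; exact mul_le_mul_of_nonneg_left h4 (by linarith)
    nlinarith
  have hlam : 0 ≤ ((x - r) * (1 - t - r) / (t * (2 - x ^ (2:ℕ) - (1 - x) * r) - x * (x - r))) := div_nonneg (mul_nonneg (by linarith) (by linarith)) hD.le
  have hcM1 : 0 ≤ ((x ^ (2:ℕ) + (1 - x) * d / w) * (1 - x) * ((x - r) * (1 - t - r) / (t * (2 - x ^ (2:ℕ) - (1 - x) * r) - x * (x - r)))) := mul_nonneg (mul_nonneg hg0 (by linarith)) hlam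
  have hgl : ((x ^ (2:ℕ) + (1 - x) * d / w) * (1 - x) * ((x - r) * (1 - t - r) / (t * (2 - x ^ (2:ℕ) - (1 - x) * r) - x * (x - r)))) ≤ (x ^ (2:ℕ) + (1 - x) * d / w) * (1 - x) := mul_le_of_le_one_right (mul_nonneg hg0 (by linarith)) (by linarith [hsum, hlaml])
  have hgsum : (x ^ (2:ℕ) + (1 - x) * d / w) * (1 - x) * ((x - r) * (1 - t - r) / (t * (2 - x ^ (2:ℕ) - (1 - x) * r) - x * (x - r))) + (x ^ (2:ℕ) + (1 - x) * d / w) * (1 - x) * ((1 + x - r) * (r - x + t * (2 - x)) / (t * (2 - x ^ (2:ℕ) - (1 - x) * r) - x * (x - r))) = (x ^ (2:ℕ) + (1 - x) * d / w) * (1 - x) := by rw [← mul_add, hsum, mul_one]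
  rcases le_or_gt (((x ^ (2:ℕ) + (1 - x) * d / w) * (1 - x) * ((x - r) * (1 - t - r) / (t * (2 - x ^ (2:ℕ) - (1 - x) * r) - x * (x - r))))) (((1 - (x ^ (2:ℕ) + (1 - x) * d / w)) * x) * e3) with hf | hs
  · obtain ⟨_, hpl⟩ := hcase_f hf
    rw [hpl]
    exact mul_nonneg hg0 (by linarith)
  · obtain ⟨_, hpl⟩ := hcase_s hs
    rw [hpl]
    clear hcase_f hcase_s
    rcases le_or_gt (x * (1 + t - w)) ((r + d + 2 * t - 2 * w)) with hk3 | hk3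
    · rw [h3_H hk3] at *
      have he3pos : 0 < (((1 + t - w) - (r + d + 2 * t - 2 * w)) / (r + d + 2 * t - 2 * w)) := div_pos (by linarith) (by linarith)
      have hcP0 : 0 ≤ ((1 - (x ^ (2:ℕ) + (1 - x) * d / w)) * x) := mul_nonneg hg1p hx0.le
      nlinarith [hgl, mul_nonneg hcP0 he3pos.le]
    · rw [h3_L hk3] at *
      have hG3pos : 0 < ((1 - x) * (r + d + 2 * t - 2 * w) + x ^ (2:ℕ) * (1 + t - w)) := add_pos_of_pos_of_nonneg (mul_pos (by linarith) (by linarith)) (mul_nonneg (sq_nonneg x) (by linarith))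
      have he3pos : 0 < (((1 + t - w) - ((1 - x) * (r + d + 2 * t - 2 * w) + x ^ (2:ℕ) * (1 + t - w))) / ((1 - x) * (r + d + 2 * t - 2 * w) + x ^ (2:ℕ) * (1 + t - w))) := div_pos (by nlinarith [mul_pos hx0 (sub_pos.2 hx1), mul_pos hx0 (show (0:ℝ) < 1 + t - w by linarith)]) hG3pos
      have he3 : (1 - x) / x ≤ (((1 + t - w) - ((1 - x) * (r + d + 2 * t - 2 * w) + x ^ (2:ℕ) * (1 + t - w))) / ((1 - x) * (r + d + 2 * t - 2 * w) + x ^ (2:ℕ) * (1 + t - w))) := by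
        rw [div_le_div_iff₀ hx0 hG3pos]; nlinarith [mul_le_mul_of_nonneg_left hk3.le (sub_pos.2 hx1).le]
      have hcP0 : 0 ≤ ((1 - (x ^ (2:ℕ) + (1 - x) * d / w)) * x) := mul_nonneg hg1p hx0.le
      nlinarith [hgl, mul_nonneg hcP0 he3pos.le]

set_option maxHeartbeats 4000000 in
/-- **low 2 never fits into `m+l′` (pattern LMG)**: `a₂(m+l′) ≤ P₂`. [this work] -/
theorem kAfact_LMG (x r t d w e22 : ℝ) (hx0 : 0 < x) (hx1 : x < 1) (hr0 : 0 ≤ r) (hrx : r < x) (_ht : 0 < t) (hw0 : 0 < w) (_hw1 : w ≤ 1)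
    (_hd0 : 0 ≤ d) (hdx : d < x * w) (hre : 0 < r - x + t * (2 - x)) (_hre1 : 0 < 1 - t - r)
    (_hM1 : 2 * w < r + d + 2 * t) (_hM2 : r + d ≤ 2 * w)
    (h22_N : w ≤ (r + d) → e22 = 0)
    (h22_H : x * w ≤ (r + d) → (r + d) < w → e22 = (w / (r + d) - 1))
    (h22_L : (r + d) < x * w → e22 = (w / ((1 - x) * (r + d) + x ^ (2:ℕ) * w) - 1)) :
    ((x ^ (2:ℕ) + (1 - x) * d / w) * (1 - x) * ((1 + x - r) * (r - x + t * (2 - x)) / (t * (2 - x ^ (2:ℕ) - (1 - x) * r) - x * (x - r)))) * e22 ≤ ((1 - (x ^ (2:ℕ) + (1 - x) * d / w)) * (1 - x) * ((1 + x - r) * (r - x + t * (2 - x)) / (t * (2 - x ^ (2:ℕ) - (1 - x) * r) - x * (x - r)))) := by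
  have hD : 0 < t * (2 - x ^ (2:ℕ) - (1 - x) * r) - x * (x - r) := LSCoreMMG.D_pos x r t hx0 hx1 hr0 hrx hre
  have hxw : x * w ≤ x := by nlinarith
  have hxw1 : x * w ≤ w := by nlinarith
  have hb3c : r + d + 2 * t - 2 * w < 1 + t - w := by nlinarith
  have hg0 : 0 ≤ (x ^ (2:ℕ) + (1 - x) * d / w) := by positivity
  have hlaml : 0 ≤ ((1 + x - r) * (r - x + t * (2 - x)) / (t * (2 - x ^ (2:ℕ) - (1 - x) * r) - x * (x - r))) := div_nonneg (mul_nonneg (by linarith) hre.le) hD.le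
  have hm : 0 ≤ (1 - x) * ((1 + x - r) * (r - x + t * (2 - x)) / (t * (2 - x ^ (2:ℕ) - (1 - x) * r) - x * (x - r))) := mul_nonneg (by linarith) hlaml
  -- `γ·w ≤ x·w` and `γ·w ≤ G22`
  have hgw : (x ^ (2:ℕ) + (1 - x) * d / w) * w = x ^ (2:ℕ) * w + (1 - x) * d := by field_simp
  rcases lt_or_ge ((r + d)) (x * w) with h22L | h22a
  · rw [h22_L h22L]
    have hG : 0 < ((1 - x) * (r + d) + x ^ (2:ℕ) * w) := by positivity
    have key : (x ^ (2:ℕ) + (1 - x) * d / w) * (w / ((1 - x) * (r + d) + x ^ (2:ℕ) * w) - 1) ≤ 1 - (x ^ (2:ℕ) + (1 - x) * d / w) := by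
      rw [show (x ^ (2:ℕ) + (1 - x) * d / w) * (w / ((1 - x) * (r + d) + x ^ (2:ℕ) * w) - 1) = (x ^ (2:ℕ) + (1 - x) * d / w) * w / ((1 - x) * (r + d) + x ^ (2:ℕ) * w) - (x ^ (2:ℕ) + (1 - x) * d / w) by ring, hgw, sub_le_iff_le_add, div_le_iff₀ hG]
      nlinarith [mul_nonneg (sub_pos.2 hx1).le hr0, hg0]
    calc ((x ^ (2:ℕ) + (1 - x) * d / w) * (1 - x) * ((1 + x - r) * (r - x + t * (2 - x)) / (t * (2 - x ^ (2:ℕ) - (1 - x) * r) - x * (x - r)))) * (w / ((1 - x) * (r + d) + x ^ (2:ℕ) * w) - 1) = ((x ^ (2:ℕ) + (1 - x) * d / w) * (w / ((1 - x) * (r + d) + x ^ (2:ℕ) * w) - 1)) * ((1 - x) * ((1 + x - r) * (r - x + t * (2 - x)) / (t * (2 - x ^ (2:ℕ) - (1 - x) * r) - x * (x - r)))) := by ring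
      _ ≤ (1 - (x ^ (2:ℕ) + (1 - x) * d / w)) * ((1 - x) * ((1 + x - r) * (r - x + t * (2 - x)) / (t * (2 - x ^ (2:ℕ) - (1 - x) * r) - x * (x - r)))) := mul_le_mul_of_nonneg_right key hm
      _ = ((1 - (x ^ (2:ℕ) + (1 - x) * d / w)) * (1 - x) * ((1 + x - r) * (r - x + t * (2 - x)) / (t * (2 - x ^ (2:ℕ) - (1 - x) * r) - x * (x - r)))) := by ring
  · rcases lt_or_ge ((r + d)) w with h22b | h22n
    · rw [h22_H h22a h22b]
      have hA : 0 < (r + d) := by nlinarith [mul_pos hx0 hw0]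
      have key : (x ^ (2:ℕ) + (1 - x) * d / w) * (w / (r + d) - 1) ≤ 1 - (x ^ (2:ℕ) + (1 - x) * d / w) := by
        rw [show (x ^ (2:ℕ) + (1 - x) * d / w) * (w / (r + d) - 1) = (x ^ (2:ℕ) + (1 - x) * d / w) * w / (r + d) - (x ^ (2:ℕ) + (1 - x) * d / w) by ring, hgw, sub_le_iff_le_add, div_le_iff₀ hA]
        nlinarith [mul_nonneg (sub_pos.2 hx1).le (sub_pos.2 hdx).le, hg0]
      calc ((x ^ (2:ℕ) + (1 - x) * d / w) * (1 - x) * ((1 + x - r) * (r - x + t * (2 - x)) / (t * (2 - x ^ (2:ℕ) - (1 - x) * r) - x * (x - r)))) * (w / (r + d) - 1) = ((x ^ (2:ℕ) + (1 - x) * d / w) * (w / (r + d) - 1)) * ((1 - x) * ((1 + x - r) * (r - x + t * (2 - x)) / (t * (2 - x ^ (2:ℕ) - (1 - x) * r) - x * (x - r)))) := by ring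
        _ ≤ (1 - (x ^ (2:ℕ) + (1 - x) * d / w)) * ((1 - x) * ((1 + x - r) * (r - x + t * (2 - x)) / (t * (2 - x ^ (2:ℕ) - (1 - x) * r) - x * (x - r)))) := mul_le_mul_of_nonneg_right key hm
        _ = ((1 - (x ^ (2:ℕ) + (1 - x) * d / w)) * (1 - x) * ((1 + x - r) * (r - x + t * (2 - x)) / (t * (2 - x ^ (2:ℕ) - (1 - x) * r) - x * (x - r)))) := by ring
    · rw [h22_N h22n, mul_zero]
      exact mul_nonneg (mul_nonneg (by nlinarith [hg0, mul_nonneg (sub_pos.2 hx1).le (sub_pos.2 hdx).le]) (by linarith)) hlaml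

end LSCoreLMG

end LawDec

end Quant

end Summit.CriticalPhenomena.PercolationContinuityZ3.Theorems
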